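import Literature.NumberTheory.DiophantineApproximation.PolylogTwoPointHermitePadeRational
import Literature.NumberTheory.DiophantineApproximation.PolylogTwoPointHermitePadeSeries
import HarnessLib

/-!
# The parity Hermite–Padé form at a rational point: `a^{n/2} · 2^w Λ^{(w)}_n(a/b)`

Topic `Literature/NumberTheory/DiophantineApproximation`. For the weight-`w` PARITY form
`Λ^{(w)}_n(y) = ∑_{u ≥ 0} K^{(w)}_n(u) y^{u+1}` of `PolylogTwoPointHermitePade.lean`
(`ParityPade.formH`) and a rational point `y = a/b` with `1 ≤ a`, `2a ≤ b`, a partial fraction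
expansion of the kernel at the naturals in the doubled variable `t = 2u`,
`K^{(w)}_n(u) = ∑_{p ≤ n} ∑_{o<w} c_{o,p}/(2u+p+1)^{o+1}` (`BallRivoal.pfEval n w c (2u)`; proved to
exist in `PolylogTwoPointHermitePadeExpansion.lean`, here it is the HYPOTHESIS `hc`), gives, with
`h = n/2` (natural division),

  `a^h · 2^w Λ^{(w)}_n(a/b) = ∑_{o<w} A_o L_{o+1}(a/b) + ∑_{o<w} B_o Θ_{o+1}(a/b) + C`,

where `L_s = ∑_{k ≥ 1} y^k/k^s` (`DilogPade.polylogSeries s (a/b)`),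
`Θ_s = ∑_{k ≥ 0} y^{k+1}/(2k+1)^s` (`ParityPade.oddPolylogSeries s (a/b)`),
`A_o = coefLiQ n w c b a o` (odd pole indices `p`), `B_o = coefThQ n w c b a o` (even `p`) and
`C = constHQ n w c b a` (`PolylogTwoPointHermitePadeRational.lean`).

* `pow_mul_formH_eq_of_pfEval` — the identity above (the rational-point analogue of
  `ParityPade.formH_eq_of_pfEval`, which is the case `a = 1`, `b = M`, and the parity analogue of
  `PolylogPade.pow_mul_formW_eq_of_pfEval`).

The computation, per pole index `p ≤ n` and order `s = o + 1`, with `i = p/2` (natural division,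
so `i ≤ h`) and the bookkeeping `b^j y^j = a^j`, `a^h = a^{h−i} · b^i y^i`: for ODD `p = 2i+1` the
denominator is even, `2u + p + 1 = 2(u+1+i)`, so
`a^h · 2^w ∑_u y^{u+1}/(2u+p+1)^s = 2^{w−s} b^i a^{h−i} (L_s − ∑_{k<i} y^{k+1}/(k+1)^s)`
(`DilogPade.pow_mul_tsum_shift`); for EVEN `p = 2i` it is odd, `2u + p + 1 = 2(u+i) + 1`, so
`a^h ∑_u y^{u+1}/(2u+p+1)^s = b^i a^{h−i} (Θ_s − ∑_{k<i} y^{k+1}/(2k+1)^s)`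
(`ParityPade.pow_mul_tsum_oddShift`); in both finite remainders `y^{k+1} = a^{k+1}/b^{k+1}`.

References: S. David, N. Hirata-Kohno, M. Kawashima, *Can polylogarithms at algebraic points be
linearly independent?*, Moscow J. Comb. Number Th. 9 (2020), Thm 2.1; M. Hata, *On the linear
independence of the values of polylogarithmic functions*, J. Math. Pures Appl. 69 (1990);
E. M. Nikišin, Mat. Sb. 109 (1979). Everything here is PROVED from Mathlib's `tsum` API and the
sibling files; no definitions, no named facts.
-/

noncomputable section

open Finset

namespace Literature.NumberTheory.DiophantineApproximation

namespace ParityPade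

open Literature.NumberTheory.Transcendental

/-- **The weight-`w` parity Hermite–Padé form at a rational point `y = a/b`**
(David–Hirata-Kohno–Kawashima 2020, the computation behind Thm 2.1 at the two points `±M/N`;
Hata 1990; Nikišin 1979). If the parity kernel has the partial fraction expansion
`K^{(w)}_n(u) = ∑_{p ≤ n} ∑_{o<w} c_{o,p}/(2u+p+1)^{o+1}` at the naturals `u`
(`BallRivoal.pfEval n w c (2u)`), then for natural numbers `1 ≤ a`, `2a ≤ b`, with `h = n/2`,
`a^h · 2^w Λ^{(w)}_n(a/b) = ∑_{o<w} A_o · L_{o+1}(a/b) + ∑_{o<w} B_o · Θ_{o+1}(a/b) + C`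
with `A_o = coefLiQ n w c b a o` (odd pole indices), `B_o = coefThQ n w c b a o` (even pole
indices), `C = constHQ n w c b a`, `L_s = DilogPade.polylogSeries s` and `Θ_s = oddPolylogSeries s`
(the rational-point analogue of `formH_eq_of_pfEval`, which is the case `a = 1`).
[cite: DavidHirataKohnoKawashima2020, Thm 2.1] -/
theorem pow_mul_formH_eq_of_pfEval {w n a b : ℕ} (ha : 1 ≤ a) (hab : 2 * a ≤ b) (c : ℕ → ℕ → ℚ)
    (hc : ∀ u : ℕ, kernelH w n u = BallRivoal.pfEval n w c (2 * u)) :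
    (a : ℝ) ^ (n / 2) * ((2 : ℝ) ^ w * formH w n ((a : ℝ) / b)) =
      (∑ o ∈ Finset.range w,
          ((coefLiQ n w c b a o : ℚ) : ℝ) * DilogPade.polylogSeries (o + 1) ((a : ℝ) / b)) +
      (∑ o ∈ Finset.range w,
          ((coefThQ n w c b a o : ℚ) : ℝ) * oddPolylogSeries (o + 1) ((a : ℝ) / b)) +
        ((constHQ n w c b a : ℚ) : ℝ) := by
  have hbpos : (0 : ℝ) < b := Nat.cast_pos.mpr (by omega)
  have hb0 : (b : ℝ) ≠ 0 := hbpos.ne'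
  set y : ℝ := (a : ℝ) / b with hy
  have hy0 : 0 ≤ y := by positivity
  have hy1 : y < 1 := by
    rw [hy, div_lt_one hbpos]
    exact_mod_cast (by omega : a < b)
  -- the rational-point bookkeeping: `b^j y^j = a^j`, so `a^{n/2} = a^{n/2 - i} · (b^i y^i)` for
  -- `i ≤ n/2`
  have hby : ∀ j : ℕ, (b : ℝ) ^ j * y ^ j = (a : ℝ) ^ j := fun j => by
    rw [← mul_pow, hy, mul_div_cancel₀ _ hb0]
  have han : ∀ i : ℕ, i ≤ n / 2 →
      (a : ℝ) ^ (n / 2) = (a : ℝ) ^ (n / 2 - i) * ((b : ℝ) ^ i * y ^ i) := fun i hi => by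
    rw [hby, ← pow_add, Nat.sub_add_cancel hi]
  -- summability of the general term `y^{u+1}/(2u+p+1)^s` (comparison with the geometric series)
  have hS : ∀ s p : ℕ, Summable fun u : ℕ => y ^ (u + 1) / (2 * (u : ℝ) + p + 1) ^ s := by
    intro s p
    refine Summable.of_nonneg_of_le (fun u => by positivity) (fun u => ?_)
      ((summable_geometric_of_lt_one hy0 hy1).mul_left y)
    rw [← pow_succ']
    exact div_le_self (pow_nonneg hy0 _) (one_le_pow₀ (le_add_of_nonneg_left (by positivity)))
  -- the two shift identities at `y = a/b`, multiplied by `a^{n/2} = a^{n/2-i} b^i y^i`: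
  -- odd pole index `p = 2i+1` (even denominators `2(u+1+i)`, the `Li` series,
  -- `2^w = 2^{w-1-o} · 2^{o+1}`) ...
  have hgOdd : ∀ o i : ℕ, o < w → i ≤ n / 2 →
      (a : ℝ) ^ (n / 2) * ((2 : ℝ) ^ w * (((c o (2 * i + 1) : ℚ) : ℝ) *
        ∑' u : ℕ, y ^ (u + 1) / (2 * (u : ℝ) + ((2 * i + 1 : ℕ) : ℝ) + 1) ^ (o + 1))) =
        ((c o (2 * i + 1) : ℚ) : ℝ) * 2 ^ (w - 1 - o) * (b : ℝ) ^ i * (a : ℝ) ^ (n / 2 - i) *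
          (DilogPade.polylogSeries (o + 1) y -
            ∑ k ∈ range i, y ^ (k + 1) / ((k : ℝ) + 1) ^ (o + 1)) := by
    intro o i ho hi
    have h2 : (2 : ℝ) ^ (o + 1) *
        ∑' u : ℕ, y ^ (u + 1) / (2 * (u : ℝ) + ((2 * i + 1 : ℕ) : ℝ) + 1) ^ (o + 1) =
          ∑' u : ℕ, y ^ (u + 1) / ((u : ℝ) + 1 + i) ^ (o + 1) := by
      rw [← tsum_mul_left]
      refine tsum_congr fun u => ?_
      rw [show (2 * (u : ℝ) + ((2 * i + 1 : ℕ) : ℝ) + 1) = 2 * ((u : ℝ) + 1 + i) by push_cast; ring,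
        mul_pow, mul_div_assoc', mul_div_mul_left _ _ (pow_ne_zero (o + 1) two_ne_zero)]
    have h2w : (2 : ℝ) ^ w = 2 ^ (w - 1 - o) * 2 ^ (o + 1) := by
      rw [← pow_add]
      congr 1
      omega
    rw [h2w, han i hi, ← DilogPade.pow_mul_tsum_shift (o + 1) i hy0 hy1, ← h2]
    ring
  -- ... and even pole index `p = 2i` (odd denominators `2(u+i)+1`, the `Θ` series).
  have hgEven : ∀ o i : ℕ, i ≤ n / 2 →
      (a : ℝ) ^ (n / 2) * ((2 : ℝ) ^ w * (((c o (2 * i) : ℚ) : ℝ) *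
        ∑' u : ℕ, y ^ (u + 1) / (2 * (u : ℝ) + ((2 * i : ℕ) : ℝ) + 1) ^ (o + 1))) =
        ((c o (2 * i) : ℚ) : ℝ) * 2 ^ w * (b : ℝ) ^ i * (a : ℝ) ^ (n / 2 - i) *
          (oddPolylogSeries (o + 1) y -
            ∑ k ∈ range i, y ^ (k + 1) / (2 * (k : ℝ) + 1) ^ (o + 1)) := by
    intro o i hi
    have h2 : ∑' u : ℕ, y ^ (u + 1) / (2 * (u : ℝ) + ((2 * i : ℕ) : ℝ) + 1) ^ (o + 1) =
        ∑' u : ℕ, y ^ (u + 1) / (2 * ((u : ℝ) + i) + 1) ^ (o + 1) := by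
      refine tsum_congr fun u => ?_
      rw [show (2 * (u : ℝ) + ((2 * i : ℕ) : ℝ) + 1) = 2 * ((u : ℝ) + i) + 1 by push_cast; ring]
    rw [h2, han i hi, ← pow_mul_tsum_oddShift (o + 1) i hy0 hy1]
    ring
  -- Step 1: expand the kernel by `hc` (cast from `ℚ` to `ℝ`) and exchange `tsum` and finite sums.
  have hterm : ∀ u : ℕ, (kernelH w n u : ℝ) * y ^ (u + 1) =
      ∑ p ∈ range (n + 1), ∑ o ∈ range w,
        (c o p : ℝ) * (y ^ (u + 1) / (2 * (u : ℝ) + p + 1) ^ (o + 1)) := by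
    intro u
    have hcu : (kernelH w n u : ℝ) =
        ∑ p ∈ range (n + 1), ∑ o ∈ range w, (c o p : ℝ) / (2 * (u : ℝ) + p + 1) ^ (o + 1) := by
      rw [hc u]
      push_cast [BallRivoal.pfEval]
      rfl
    rw [hcu, Finset.sum_mul]
    refine Finset.sum_congr rfl fun p _ => ?_
    rw [Finset.sum_mul]
    refine Finset.sum_congr rfl fun o _ => ?_
    ring
  have h1 : formH w n y = ∑ p ∈ range (n + 1), ∑ o ∈ range w,
      (c o p : ℝ) * ∑' u : ℕ, y ^ (u + 1) / (2 * (u : ℝ) + p + 1) ^ (o + 1) := by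
    rw [formH, tsum_congr hterm, Summable.tsum_finsetSum fun p _ =>
      summable_sum fun o _ => (hS (o + 1) p).mul_left (c o p : ℝ)]
    refine Finset.sum_congr rfl fun p _ => ?_
    rw [Summable.tsum_finsetSum fun o _ => (hS (o + 1) p).mul_left (c o p : ℝ)]
    refine Finset.sum_congr rfl fun o _ => ?_
    exact tsum_mul_left
  -- Step 2: per pole index `p` and order `o + 1`, insert the shift identity of the right parity
  -- and evaluate the finite remainder at `y = a/b` (`y^{k+1} = a^{k+1}/b^{k+1}`, `i = p/2`).
  have h2 : (a : ℝ) ^ (n / 2) * ((2 : ℝ) ^ w * formH w n y) = ∑ p ∈ range (n + 1), ∑ o ∈ range w,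
      (((if Odd p then c o p * 2 ^ (w - 1 - o) * (b : ℚ) ^ (p / 2) * (a : ℚ) ^ (n / 2 - p / 2)
          else 0 : ℚ) : ℝ) * DilogPade.polylogSeries (o + 1) y +
        ((if Even p then c o p * 2 ^ w * (b : ℚ) ^ (p / 2) * (a : ℚ) ^ (n / 2 - p / 2)
          else 0 : ℚ) : ℝ) * oddPolylogSeries (o + 1) y -
        ((c o p *
          (if Odd p then
            (2 : ℚ) ^ (w - 1 - o) *
              ∑ k ∈ range (p / 2), (b : ℚ) ^ (p / 2) * (a : ℚ) ^ (n / 2 - p / 2) *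
                ((a : ℚ) ^ (k + 1) / ((b : ℚ) ^ (k + 1) * ((k : ℚ) + 1) ^ (o + 1)))
           else
            (2 : ℚ) ^ w *
              ∑ k ∈ range (p / 2), (b : ℚ) ^ (p / 2) * (a : ℚ) ^ (n / 2 - p / 2) *
                ((a : ℚ) ^ (k + 1) / ((b : ℚ) ^ (k + 1) * (2 * (k : ℚ) + 1) ^ (o + 1)))) : ℚ) :
            ℝ)) := by
    rw [h1, Finset.mul_sum, Finset.mul_sum]
    refine Finset.sum_congr rfl fun p hp => ?_
    rw [Finset.mul_sum, Finset.mul_sum]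
    refine Finset.sum_congr rfl fun o ho => ?_
    replace ho : o < w := Finset.mem_range.mp ho
    have hpn : p ≤ n := Nat.lt_succ_iff.mp (Finset.mem_range.mp hp)
    obtain ⟨i, rfl | rfl⟩ := Nat.even_or_odd' p
    · -- even pole index `p = 2i`: the `Θ` series
      have hi : 2 * i / 2 = i := by omega
      have hin : i ≤ n / 2 := by omega
      have hev : Even (2 * i) := even_two_mul i
      have hnodd : ¬Odd (2 * i) := Nat.not_odd_iff_even.mpr hev
      have hfin : (b : ℝ) ^ i * (a : ℝ) ^ (n / 2 - i) *
          ∑ k ∈ range i, y ^ (k + 1) / (2 * (k : ℝ) + 1) ^ (o + 1) =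
          ∑ k ∈ range i, (b : ℝ) ^ i * (a : ℝ) ^ (n / 2 - i) *
            ((a : ℝ) ^ (k + 1) / ((b : ℝ) ^ (k + 1) * (2 * (k : ℝ) + 1) ^ (o + 1))) := by
        rw [Finset.mul_sum]
        refine Finset.sum_congr rfl fun k _ => ?_
        rw [hy, div_pow, div_div]
      rw [hgEven o i hin]
      simp only [if_neg hnodd, if_pos hev, hi]
      push_cast
      rw [← hfin]
      ring
    · -- odd pole index `p = 2i+1`: the `Li` series
      have hi : (2 * i + 1) / 2 = i := by omega
      have hin : i ≤ n / 2 := by omega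
      have hodd : Odd (2 * i + 1) := odd_two_mul_add_one i
      have hnev : ¬Even (2 * i + 1) := Nat.not_even_iff_odd.mpr hodd
      have hfin : (b : ℝ) ^ i * (a : ℝ) ^ (n / 2 - i) *
          ∑ k ∈ range i, y ^ (k + 1) / ((k : ℝ) + 1) ^ (o + 1) =
          ∑ k ∈ range i, (b : ℝ) ^ i * (a : ℝ) ^ (n / 2 - i) *
            ((a : ℝ) ^ (k + 1) / ((b : ℝ) ^ (k + 1) * ((k : ℝ) + 1) ^ (o + 1))) := by
        rw [Finset.mul_sum]
        refine Finset.sum_congr rfl fun k _ => ?_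
        rw [hy, div_pow, div_div]
      rw [hgOdd o i ho hin]
      simp only [if_pos hodd, if_neg hnev, hi]
      push_cast
      rw [← hfin]
      ring
  -- Step 3: swap the two finite sums and identify the coefficients.
  have hA : ∀ o : ℕ, ((coefLiQ n w c b a o : ℚ) : ℝ) * DilogPade.polylogSeries (o + 1) y =
      ∑ p ∈ range (n + 1),
        ((if Odd p then c o p * 2 ^ (w - 1 - o) * (b : ℚ) ^ (p / 2) * (a : ℚ) ^ (n / 2 - p / 2)
          else 0 : ℚ) : ℝ) * DilogPade.polylogSeries (o + 1) y := by
    intro o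
    rw [coefLiQ, Rat.cast_sum, Finset.sum_mul]
  have hB : ∀ o : ℕ, ((coefThQ n w c b a o : ℚ) : ℝ) * oddPolylogSeries (o + 1) y =
      ∑ p ∈ range (n + 1),
        ((if Even p then c o p * 2 ^ w * (b : ℚ) ^ (p / 2) * (a : ℚ) ^ (n / 2 - p / 2)
          else 0 : ℚ) : ℝ) * oddPolylogSeries (o + 1) y := by
    intro o
    rw [coefThQ, Rat.cast_sum, Finset.sum_mul]
  have hC : ((constHQ n w c b a : ℚ) : ℝ) = -∑ o ∈ range w, ∑ p ∈ range (n + 1),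
      ((c o p *
        (if Odd p then
          (2 : ℚ) ^ (w - 1 - o) *
            ∑ k ∈ range (p / 2), (b : ℚ) ^ (p / 2) * (a : ℚ) ^ (n / 2 - p / 2) *
              ((a : ℚ) ^ (k + 1) / ((b : ℚ) ^ (k + 1) * ((k : ℚ) + 1) ^ (o + 1)))
         else
          (2 : ℚ) ^ w *
            ∑ k ∈ range (p / 2), (b : ℚ) ^ (p / 2) * (a : ℚ) ^ (n / 2 - p / 2) *
              ((a : ℚ) ^ (k + 1) / ((b : ℚ) ^ (k + 1) * (2 * (k : ℚ) + 1) ^ (o + 1)))) : ℚ) :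
          ℝ) := by
    simp only [constHQ, Rat.cast_neg, Rat.cast_sum]
  rw [h2, Finset.sum_comm]
  simp only [Finset.sum_sub_distrib, Finset.sum_add_distrib]
  simp_rw [hA, hB]
  rw [hC]
  ring

end ParityPade

end Literature.NumberTheory.DiophantineApproximation
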